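import Mathlib
import Summits.QuantumFields.YangMills.Theses.AntiScreeningCeilings

/-!
# Route `AntiScreeningCeilings` — glue of the split of `MaximalSeparationCeiling` (stmt-QuantumFields-27279)

`MaximalSeparationSplitGlue : TopBandCeiling → FemtoAntipodalCeiling → MaximalSeparationCeiling` — case analysis on the parent's
maximality disjunction `ℓ < 2R₂s ∨ L < 4R₂+12`, merging the constants (min of the ε₀'s and ℓ₄'s, max of the C's and β₄'s).
Pure logic + monotonicity of `x ↦ (x/R₂⁴)²` in `x ≥ 0`; no summit / leaf / NT / UV / IR statement is proved here (ym-idea-11 g4, LINE B).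
-/

set_option autoImplicit false

namespace Summit.QuantumFields.YangMills.Theses.AntiScreeningCeilings

/-- closes the glue item stmt-QuantumFields-27279 (children ⟹ parent); proves only the implication. -/
theorem maximalSeparationSplitGlue_proof : MaximalSeparationSplitGlue := by
  intro hT hV G i1 i2 i3 i4 hG hSU r v f g h Λ₅
  obtain ⟨εA, hεA, HA⟩ := hT G hG hSU r v f g h Λ₅
  obtain ⟨εB, hεB, HB⟩ := hV G hG hSU r v f g h Λ₅
  refine ⟨min εA εB, lt_min hεA hεB, ?_⟩
  intro ε hε hεle hfl
  obtain ⟨ℓA, hℓA, HA1⟩ := HA ε hε (le_trans hεle (min_le_left _ _)) hfl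
  obtain ⟨ℓB, hℓB, HB1⟩ := HB ε hε (le_trans hεle (min_le_right _ _)) hfl
  refine ⟨min ℓA ℓB, lt_min hℓA hℓB, ?_⟩
  intro ℓ hℓ hℓle
  obtain ⟨CA, βA, hCA, HA2⟩ := HA1 ℓ hℓ (le_trans hℓle (min_le_left _ _))
  obtain ⟨CB, βB, hCB, HB2⟩ := HB1 ℓ hℓ (le_trans hℓle (min_le_right _ _))
  refine ⟨max CA CB, max βA βB, le_trans hCA (le_max_left _ _), ?_⟩
  intro β hβ s hs hs1 hsub hnear L q k R₂ t hq hR hRs hL hdisj ht htL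
  have hR₂pos : (0 : ℝ) < (R₂ : ℝ) ^ 4 := by positivity
  rcases hdisj with hTop | hVol
  · have h1 := HA2 β (le_trans (le_max_left _ _) hβ) s hs hs1 hsub hnear L q k R₂ t hq hR hRs hL hTop ht htL
    refine le_trans h1 ?_
    have : CA / (R₂ : ℝ) ^ 4 ≤ max CA CB / (R₂ : ℝ) ^ 4 :=
      div_le_div_of_nonneg_right (le_max_left _ _) hR₂pos.le
    exact pow_le_pow_left₀ (div_nonneg hCA hR₂pos.le) this 2
  · have h1 := HB2 β (le_trans (le_max_right _ _) hβ) s hs hs1 hsub hnear L q k R₂ t hq hR hRs hL hVol ht htL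
    refine le_trans h1 ?_
    have : CB / (R₂ : ℝ) ^ 4 ≤ max CA CB / (R₂ : ℝ) ^ 4 :=
      div_le_div_of_nonneg_right (le_max_right _ _) hR₂pos.le
    exact pow_le_pow_left₀ (div_nonneg hCB hR₂pos.le) this 2


end Summit.QuantumFields.YangMills.Theses.AntiScreeningCeilings
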